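import Literature.AlgebraicGeometry.AbelianSchemes.SerreTensorIsogeny               -- ★ `RingAction.i_natCast`
import Literature.AlgebraicGeometry.AbelianSchemes.AbelianSchemeOverMulNFiniteFlat   -- ★ `surjective_pow_id_left_of_ne_zero`
import HarnessLib

/-!
# A homomorphism through which `ι(N)` factors is surjective (the Serre presentation (t1) of a cover at `a = N ∈ 𝔞` makes the cover surjective)
# ([MumfordAV1970] §6 Application 2: `[N]` is surjective; [Kottwitz1992] §5: `ι(N) = [N]`)

Topic `AlgebraicGeometry/AbelianSchemes`, namespace `Literature.AlgebraicGeometry.AbelianSchemes.AbelianSchemeOver`.  THEOREMS ONLY.  Cell `hodgecm-mathlib`, P6,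
line L3 (socket `stub_FROB`, COVER road A): the input `[Surjective c.left]` of ★ `exists_frobCover_specialFibre` ∕ ★ `exists_iso_coverLeg_comp_eq_of_forall_points_of_charZero`
from clause (t1) of the P6a letter `CoverΩ` at `a := N ∈ 𝔞` (★ `natCast_mem_of_quasiInverse`): `d ≫ c = ι(N) = [N]` with `[N]` surjective (`N ≠ 0`).
HC_CM is proved only modulo the printed citations until rung 0 closes; generic, count-neutral.

## References
* [MumfordAV1970] D. Mumford, *Abelian Varieties* (1970), §6 Application 2 (p. 62) (`n_X` is surjective).
* [Kottwitz1992] R. Kottwitz, *Points on some Shimura varieties over finite fields*, JAMS 5 (1992), §5 (p. 390).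
-/

set_option autoImplicit false

noncomputable section

universe u

open CategoryTheory AlgebraicGeometry
open scoped MonObj

namespace Literature.AlgebraicGeometry.AbelianSchemes

namespace AbelianSchemeOver

variable {S : Scheme.{u}} {A B : AbelianSchemeOver S} {O : Type*} [CommRing O] (act : B.RingAction O)

/-- **A homomorphism `c : A → B` through which `ι(N)` factors (`d ≫ c = ι(N)`, `N ≠ 0`) is surjective**: `ι(N) = [N]` (★ `RingAction.i_natCast`) is surjective
(★ `surjective_pow_id_left_of_ne_zero`), and the second factor of a surjective composite is surjective. [cite: MumfordAV1970, §6 Application 2 (p. 62)]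
[cite: Kottwitz1992, §5 (p. 390)] -/
theorem surjective_left_of_comp_eq_i_natCast (c : A.X ⟶ B.X) (d : B.X ⟶ A.X) {N : ℕ} (hN : N ≠ 0) (h : d ≫ c = act.i (N : O)) :
    Surjective c.left := by
  have hs : Function.Surjective (d ≫ c).left.base := by
    rw [h, RingAction.i_natCast]
    exact (B.surjective_pow_id_left_of_ne_zero hN).surj
  rw [Over.comp_left, Scheme.Hom.comp_base, TopCat.coe_comp] at hs
  exact ⟨hs.of_comp⟩

/-- The same from a two-sided Serre presentation clause «`∀ a ∈ 𝔞, ∃ d, c ≫ d = ι_A(a) ∧ d ≫ c = ι_B(a)`» (P6a `CoverΩ` (t1)) and a natural number `N ∈ 𝔞`, `N ≠ 0`.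
[cite: MumfordAV1970, §6 Application 2 (p. 62)] [cite: Kottwitz1992, §5 (p. 390)] -/
theorem surjective_left_of_serrePresentation (actA : A.RingAction O) (c : A.X ⟶ B.X) {𝔞 : Ideal O}
    (ht1 : ∀ a ∈ 𝔞, ∃ d : B.X ⟶ A.X, c ≫ d = actA.i a ∧ d ≫ c = act.i a) {N : ℕ} (hN : N ≠ 0) (hN𝔞 : (N : O) ∈ 𝔞) :
    Surjective c.left := by
  obtain ⟨d, -, hd⟩ := ht1 (N : O) hN𝔞
  exact surjective_left_of_comp_eq_i_natCast act c d hN hd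

end AbelianSchemeOver

end Literature.AlgebraicGeometry.AbelianSchemes

end
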